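import Mathlib.MeasureTheory.Measure.Haar.InnerProductSpace
import Mathlib.MeasureTheory.Function.LpSeminorm.Basic
import Literature.Analysis.FluidPDE.ClassicalSolution
import HarnessLib

/-!
# The kinematic induction equation in Hubble flow and the kinematic anti-dynamo threshold

The **kinematic induction equation** of magnetohydrodynamics for a solenoidal field `B` carried
by a *prescribed* velocity field `V` with magnetic diffusivity `ν`,
`∂ₛ B = ν ΔB + curl (V × B)`, `div B = 0` (Davidson 2001, §2.8 eq. (2.64); Ch. 5, "kinematics of
MHD", eqs. (5.1)–(5.2): the analogy with the vorticity equation `∂ₜω = νΔω + curl(u × ω)`),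
specialised to advecting velocities `V(s, y) = U(s, y) + a·y` — a profile flow `U` superposed on
the uniform ("Hubble") expansion `a·y` (`div (a·y) = 3a` in `ℝ³`). With the in-tree `curl`/`cross`,
`curl (a·y × B) = −2a B − a (y·∇)B` for solenoidal `B`; hence for a Leray similarity profile `U` and
`B = curl U` the equation is *verbatim* the vorticity equation in Leray's similarity variables
`u(x,t) = λ U(λx, s)`, `λ = (2a(T−t))^{-1/2}`, `ds/dt = λ²` (Leray 1934, §20), whose two extra terms
`−2aΩ − a(y·∇)Ω` are exactly `curl(a·y × Ω)`. This file records only the LINEAR (kinematic)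
problem: `U` is NOT required to be `curl⁻¹ B`.

## Main definitions

* `Literature.Analysis.FluidPDE.IsAdmissibleHubbleFlow C U`: admissible advecting fields at
  pointwise Type-I level `C` — `U : ℝ → E → E` jointly smooth in `(s, y)`, divergence-free slices,
  `sup_s (1 + ‖y‖) ‖U s y‖ ≤ C` and `sup_s (1 + ‖y‖)² ‖∇U s y‖ ≤ C`.
* `Literature.Analysis.FluidPDE.IsInductionSolutionOn S ν a U B`: classical solutions of the
  induction equation in the Hubble flow `U + a·y` on a time set `S ⊆ ℝ` (fields on `ℝ³`, time
  first; the shape of `IsClassicalNSSolutionOn S`: joint smoothness on `S × ℝ³`, one-sided time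
  derivative `timeDerivWithin S`, the equation pointwise, solenoidal slices).
* `Literature.Analysis.FluidPDE.IsEternalInductionSolution ν a U B`: `S = univ` together with
  square-integrable slices and `sup_s ∫ ‖B s y‖² dy < ∞` ("a field maintained for all times").
* `Literature.Analysis.FluidPDE.KinematicHubbleAntiDynamo ν a C`: the kinematic anti-dynamo property
  at level `C` — for every admissible `U` at level `C`, every eternal solution is `0`.
* `Literature.Analysis.FluidPDE.kinematicHubbleThreshold ν a : ℝ≥0∞`: the **kinematic anti-dynamo
  threshold in Hubble flow**, `sup {C ≥ 0 : KinematicHubbleAntiDynamo ν a C}` in `[0, ∞]`, with its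
  order interface (`ofReal_le_kinematicHubbleThreshold`, `kinematicHubbleThreshold_le_ofReal`,
  `kinematicHubbleAntiDynamo_of_ofReal_lt`, `kinematicHubbleThreshold_eq_top_iff`, `…_eq_sSup`).

## Design notes

* Parameter order `(ν a)` = (diffusivity, Hubble rate) as in `IsLerayProfile ν a`; the intended
  regime is `0 < ν`, `0 < a`, but the definitions are total.
* The equation is typed as in the route files that consume it: right-hand side
  `ν • Δ (B s) y + curl (fun z => cross (U s z + a • z) (B s z)) y`, time derivative
  `timeDerivWithin S B s y` (`= deriv (B · y) s` for `S = univ`, `IsEternalInductionSolution.deriv_eq`),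
  smoothness `IsSmoothSpaceTimeOn S B`, solenoidality `VectorCalculus.IsDivFree (B s)`.
* `IsEternalInductionSolution` asks for `MemLp (B s) 2` explicitly: with the Bochner junk value
  `∫ = 0` for non-integrable slices a bare bound `∫ ‖B s y‖² ≤ M` would be VACUOUS (e.g. the
  spatially constant eternal solution `B s y = exp (−2as) • e` of the flow at rest would pass it).
* For `C < 0` there is no admissible field (`IsAdmissibleHubbleFlow.nonneg`), so
  `KinematicHubbleAntiDynamo ν a C` holds vacuously (`KinematicHubbleAntiDynamo.of_neg`); the
  threshold ranges over levels `C : ℝ≥0` only.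
* `IsAdmissibleHubbleFlow` is stated on any real inner product space `E` (physical case `E = ℝ³`);
  the induction equation uses the in-tree `curl`/`cross` and is therefore three-dimensional.

## What is NOT here

Nothing about the VALUE of the threshold: the energy-method lower bound
`√(2aν) ≤ kinematicHubbleThreshold ν a` (magnetic Reynolds number `C²/(aν) < 2`, a Backus-type
bound, cf. Backus 1958), its finiteness, and certified numerical lower bounds are separate results,
deliberately not vendored here as named facts.

## References

* P. A. Davidson, *An Introduction to Magnetohydrodynamics*, CUP 2001: §2.8 eq. (2.64), §5.1
  eqs. (5.1)–(5.2), Ch. 5 (kinematics of MHD).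
* G. Backus, *A class of self-sustaining dissipative spherical dynamos*, Ann. Phys. 4 (1958).
* J. Leray, *Sur le mouvement d'un liquide visqueux emplissant l'espace*, Acta Math. 63 (1934), §20.
-/

noncomputable section

open MeasureTheory Set Function
open scoped ContDiff Laplacian InnerProductSpace RealInnerProductSpace ENNReal NNReal

namespace Literature.Analysis.FluidPDE

/-! ### Admissible advecting fields: the pointwise Type-I profile class -/

section Admissible

variable {E : Type*} [NormedAddCommGroup E] [InnerProductSpace ℝ E]

/-- An **admissible advecting field at (pointwise Type-I) level `C`** for the kinematic dynamo
problem in Hubble flow: a time-dependent field `U : ℝ → E → E` (time `s` first) which is jointly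
`C^∞` in `(s, y)` on `ℝ × E`, has divergence-free time slices, and obeys the scale-invariant profile
bounds `(1 + ‖y‖) ‖U s y‖ ≤ C` and `(1 + ‖y‖)² ‖DU(s)(y)‖ ≤ C` (operator norm of the Fréchet
derivative of the slice) for all `s, y` — the similarity-variable form of the Type-I bound
`‖u(t,x)‖ ≤ C / (‖x‖ + √(−t))` (`HasTypeIDecay`) one derivative up. The advecting velocity is then
the Hubble flow `U s y + a • y` (`IsInductionSolutionOn`); `U` is NOT required to be a Biot–Savart
field (kinematic problem). Empty for `C < 0` (`IsAdmissibleHubbleFlow.nonneg`). [folklore] -/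
structure IsAdmissibleHubbleFlow (C : ℝ) (U : ℝ → E → E) : Prop where
  /-- `U` is jointly smooth on `ℝ × E`. -/
  smooth : IsSmoothSpaceTimeOn univ U
  /-- Every time slice is divergence free. -/
  divFree : ∀ s, VectorCalculus.IsDivFree (U s)
  /-- Type-I velocity bound `sup_s (1 + ‖y‖) ‖U s y‖ ≤ C`. -/
  norm_le : ∀ s y, (1 + ‖y‖) * ‖U s y‖ ≤ C
  /-- Type-I gradient bound `sup_s (1 + ‖y‖)² ‖DU(s)(y)‖ ≤ C`. -/
  norm_fderiv_le : ∀ s y, (1 + ‖y‖) ^ 2 * ‖fderiv ℝ (U s) y‖ ≤ C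

namespace IsAdmissibleHubbleFlow

variable {C C' : ℝ} {U : ℝ → E → E}

/-- The level of an admissible field is nonnegative (evaluate the velocity bound anywhere). [folklore] -/
theorem nonneg (h : IsAdmissibleHubbleFlow C U) : 0 ≤ C :=
  le_trans (mul_nonneg (by positivity) (norm_nonneg _)) (h.norm_le 0 0)

/-- Admissibility is monotone in the level. [folklore] -/
theorem mono (h : IsAdmissibleHubbleFlow C U) (hC : C ≤ C') : IsAdmissibleHubbleFlow C' U where
  smooth := h.smooth
  divFree := h.divFree
  norm_le s y := (h.norm_le s y).trans hC
  norm_fderiv_le s y := (h.norm_fderiv_le s y).trans hC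

/-- Time slices of an admissible field are smooth. [folklore] -/
theorem contDiff_slice (h : IsAdmissibleHubbleFlow C U) (s : ℝ) : ContDiff ℝ ∞ (U s) :=
  h.smooth.contDiff_slice (mem_univ s)

/-- An admissible field is jointly smooth on all of `ℝ × E`. [folklore] -/
theorem contDiff_uncurry (h : IsAdmissibleHubbleFlow C U) : ContDiff ℝ ∞ (uncurry U) := by
  rw [← contDiffOn_univ, ← univ_prod_univ]
  exact h.smooth

/-- Division form of the velocity bound: `‖U s y‖ ≤ C / (1 + ‖y‖)`. [folklore] -/
theorem norm_le_div (h : IsAdmissibleHubbleFlow C U) (s : ℝ) (y : E) :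
    ‖U s y‖ ≤ C / (1 + ‖y‖) := by
  rw [le_div_iff₀ (by positivity), mul_comm]
  exact h.norm_le s y

/-- Division form of the gradient bound: `‖DU(s)(y)‖ ≤ C / (1 + ‖y‖)²`. [folklore] -/
theorem norm_fderiv_le_div (h : IsAdmissibleHubbleFlow C U) (s : ℝ) (y : E) :
    ‖fderiv ℝ (U s) y‖ ≤ C / (1 + ‖y‖) ^ 2 := by
  rw [le_div_iff₀ (by positivity), mul_comm]
  exact h.norm_fderiv_le s y

/-- An admissible field at level `C` is bounded by `C` (drop the weight `1 + ‖y‖ ≥ 1`). [folklore] -/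
theorem norm_le_level (h : IsAdmissibleHubbleFlow C U) (s : ℝ) (y : E) : ‖U s y‖ ≤ C :=
  le_trans (le_mul_of_one_le_left (norm_nonneg _) (le_add_of_nonneg_right (norm_nonneg _)))
    (h.norm_le s y)

/-- The gradient of an admissible field at level `C` is bounded by `C`. [folklore] -/
theorem norm_fderiv_le_level (h : IsAdmissibleHubbleFlow C U) (s : ℝ) (y : E) :
    ‖fderiv ℝ (U s) y‖ ≤ C :=
  le_trans (le_mul_of_one_le_left (norm_nonneg _)
    (one_le_pow₀ (le_add_of_nonneg_right (norm_nonneg _)))) (h.norm_fderiv_le s y)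

/-- The fluid at rest, `U = 0`, is admissible at every level `C ≥ 0` (pure Hubble flow). [folklore] -/
theorem zero (hC : 0 ≤ C) : IsAdmissibleHubbleFlow C (0 : ℝ → E → E) where
  smooth := by
    change ContDiffOn ℝ ∞ (fun _ : ℝ × E => (0 : E)) (univ ×ˢ univ)
    exact contDiffOn_const
  divFree s y := by simp [VectorCalculus.divergence]
  norm_le s y := by simpa using hC
  norm_fderiv_le s y := by simpa using hC

end IsAdmissibleHubbleFlow

end Admissible

/-! ### The kinematic induction equation in the Hubble flow `U + a·y` -/

section Induction

local notation "ℝ³" => EuclideanSpace ℝ (Fin 3)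

/-- **Classical solutions of the kinematic induction equation in Hubble flow** on a time set
`S ⊆ ℝ`: `B : ℝ → ℝ³ → ℝ³` (time `s` first) is jointly `C^∞` on `S × ℝ³` and satisfies, pointwise
on `S × ℝ³`,

  `∂ₛ B = ν ΔB + curl ((U + a·y) × B)`,  `div B = 0`,

the induction equation of MHD (Davidson 2001, eq. (2.64)/(5.1): `∂B/∂t = ∇×(u×B) + λ∇²B`) for the
advecting velocity `V(s,y) = U s y + a • y` and magnetic diffusivity `ν`. The time derivative is
the one-sided `timeDerivWithin S` of `IsClassicalNSSolutionOn`; `Δ` is Mathlib's Laplacian of the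
slice; `curl`, `cross` are the in-tree operators. No condition ties `U` to `B` (kinematic problem).
[cite: Davidson2001, §2.8 eq. (2.64) and §5.1 eq. (5.1)] -/
structure IsInductionSolutionOn (S : Set ℝ) (ν a : ℝ) (U B : ℝ → ℝ³ → ℝ³) : Prop where
  /-- The field is jointly smooth on `S × ℝ³`. -/
  smooth : IsSmoothSpaceTimeOn S B
  /-- The induction equation `∂ₛB = νΔB + curl((U + a·y) × B)` pointwise on `S × ℝ³`. -/
  induction_eq : ∀ s ∈ S, ∀ y,
    timeDerivWithin S B s y = ν • (Δ (B s)) y + curl (fun z => cross (U s z + a • z) (B s z)) y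
  /-- The field is solenoidal: `div B(s) = 0` for `s ∈ S`. -/
  divFree : ∀ s ∈ S, VectorCalculus.IsDivFree (B s)

/-- **Eternal finite-energy solutions** ("a field maintained for all times"): a classical solution
of the induction equation in the Hubble flow `U + a·y` on the whole time axis whose slices are
square integrable with `sup_s ∫ ‖B s y‖² dy < ∞`. Square-integrability is required explicitly
(a bare integral bound would be vacuous through the junk value of the Bochner integral). [folklore] -/
structure IsEternalInductionSolution (ν a : ℝ) (U B : ℝ → ℝ³ → ℝ³) : Prop
    extends IsInductionSolutionOn univ ν a U B where
  /-- Every time slice is square integrable. -/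
  memLp : ∀ s, MemLp (B s) 2 volume
  /-- The energy is bounded uniformly in time: `sup_s ∫ ‖B s y‖² dy < ∞`. -/
  exists_integral_le : ∃ M : ℝ, ∀ s, ∫ y, ‖B s y‖ ^ 2 ≤ M

/-- The cross product with the zero vector vanishes (bilinearity of `crossProduct`). [folklore] -/
@[simp]
theorem cross_zero_right (v : ℝ³) : cross v 0 = 0 := by
  simp [cross]

/-- The cross product of the zero vector vanishes. [folklore] -/
@[simp]
theorem cross_zero_left (v : ℝ³) : cross 0 v = 0 := by
  simp [cross]

namespace IsInductionSolutionOn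

variable {S S' : Set ℝ} {ν a : ℝ} {U B : ℝ → ℝ³ → ℝ³}

/-- Time slices of a solution are smooth. [folklore] -/
theorem contDiff_slice (h : IsInductionSolutionOn S ν a U B) {s : ℝ} (hs : s ∈ S) :
    ContDiff ℝ ∞ (B s) :=
  h.smooth.contDiff_slice hs

/-- Restriction to a smaller time set of unique differentiability (e.g. a nontrivial interval):
the one-sided time derivatives agree there. [folklore] -/
theorem mono (h : IsInductionSolutionOn S ν a U B) (hS' : S' ⊆ S) (hU : UniqueDiffOn ℝ S') :
    IsInductionSolutionOn S' ν a U B where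
  smooth := h.smooth.mono hS'
  induction_eq s hs y := by
    rw [h.smooth.timeDerivWithin_eq_of_subset hS' hU hs y]
    exact h.induction_eq s (hS' hs) y
  divFree s hs := h.divFree s (hS' hs)

/-- The trivial field `B = 0` solves the induction equation for every advecting field. [folklore] -/
theorem zero (S : Set ℝ) (ν a : ℝ) (U : ℝ → ℝ³ → ℝ³) :
    IsInductionSolutionOn S ν a U (0 : ℝ → ℝ³ → ℝ³) where
  smooth := by
    change ContDiffOn ℝ ∞ (fun _ : ℝ × ℝ³ => (0 : ℝ³)) (S ×ˢ univ)
    exact contDiffOn_const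
  induction_eq s _ y := by
    have hΔ : (Δ (0 : ℝ³ → ℝ³)) y = 0 := by
      rw [InnerProductSpace.laplacian_eq_iteratedFDeriv_stdOrthonormalBasis]
      simp
    -- `curl` of the zero field (also `curl_fun_zero` of `VorticityCalculus`, not imported here)
    have hcurl : curl (fun _ : ℝ³ => (0 : ℝ³)) y = 0 := by
      ext i
      fin_cases i <;> simp [curl]
    simp [timeDerivWithin, hΔ, hcurl]
  divFree s _ y := by simp [VectorCalculus.divergence]

end IsInductionSolutionOn

namespace IsEternalInductionSolution

variable {ν a : ℝ} {U B : ℝ → ℝ³ → ℝ³}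

/-- An eternal solution is jointly smooth on all of `ℝ × ℝ³`. [folklore] -/
theorem contDiff_uncurry (h : IsEternalInductionSolution ν a U B) : ContDiff ℝ ∞ (uncurry B) := by
  rw [← contDiffOn_univ, ← univ_prod_univ]
  exact h.smooth

/-- Time slices of an eternal solution are smooth. [folklore] -/
theorem contDiff_slice (h : IsEternalInductionSolution ν a U B) (s : ℝ) : ContDiff ℝ ∞ (B s) :=
  h.smooth.contDiff_slice (mem_univ s)

/-- On the whole time axis the one-sided time derivative is the ordinary derivative:
`d/ds B(s, y) = ν ΔB(s)(y) + curl((U(s) + a·y) × B(s))(y)`. [folklore] -/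
theorem deriv_eq (h : IsEternalInductionSolution ν a U B) (s : ℝ) (y : ℝ³) :
    deriv (fun τ => B τ y) s =
      ν • (Δ (B s)) y + curl (fun z => cross (U s z + a • z) (B s z)) y := by
  rw [← derivWithin_univ, ← timeDerivWithin_apply]
  exact h.induction_eq s (mem_univ s) y

/-- The trivial field `B = 0` is an eternal solution for every advecting field. [folklore] -/
theorem zero (ν a : ℝ) (U : ℝ → ℝ³ → ℝ³) : IsEternalInductionSolution ν a U (0 : ℝ → ℝ³ → ℝ³) where
  toIsInductionSolutionOn := IsInductionSolutionOn.zero univ ν a U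
  memLp _ := MemLp.zero
  exists_integral_le := ⟨0, fun s => by simp⟩

end IsEternalInductionSolution

/-! ### The kinematic anti-dynamo property and the threshold -/

/-- The **kinematic anti-dynamo property in Hubble flow at level `C`** (diffusivity `ν`, Hubble
rate `a`): NO admissible advecting field `U` at level `C` maintains a field — for every
`U` with `IsAdmissibleHubbleFlow C U` the only eternal finite-energy solution of
`∂ₛB = νΔB + curl((U + a·y) × B)`, `div B = 0`, is `B = 0`. Antitone in `C`, vacuous for `C < 0`.
A Type-I Liouville statement for the LINEAR problem: it never uses `U = curl⁻¹ B`. [folklore] -/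
def KinematicHubbleAntiDynamo (ν a C : ℝ) : Prop :=
  ∀ ⦃U B : ℝ → ℝ³ → ℝ³⦄, IsAdmissibleHubbleFlow C U → IsEternalInductionSolution ν a U B → B = 0

namespace KinematicHubbleAntiDynamo

variable {ν a C C' : ℝ}

/-- The anti-dynamo property is inherited by smaller levels. [folklore] -/
theorem anti (h : KinematicHubbleAntiDynamo ν a C) (hC : C' ≤ C) :
    KinematicHubbleAntiDynamo ν a C' := fun _ _ hU hB => h (hU.mono hC) hB

/-- Below level `0` there is no admissible field, so the property holds vacuously. [folklore] -/
theorem of_neg (hC : C < 0) : KinematicHubbleAntiDynamo ν a C :=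
  fun _ _ hU _ => absurd hU.nonneg (not_le.2 hC)

/-- Pointwise form of the conclusion. [folklore] -/
theorem eq_zero (h : KinematicHubbleAntiDynamo ν a C) {U B : ℝ → ℝ³ → ℝ³}
    (hU : IsAdmissibleHubbleFlow C U) (hB : IsEternalInductionSolution ν a U B) (s : ℝ) (y : ℝ³) :
    B s y = 0 := by
  rw [h hU hB]
  rfl

end KinematicHubbleAntiDynamo

/-- The levels with the anti-dynamo property form a down-set of `ℝ`. [folklore] -/
theorem kinematicHubbleAntiDynamo_antitone (ν a : ℝ) : Antitone (KinematicHubbleAntiDynamo ν a) :=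
  fun _ _ hC h => h.anti hC

/-- The **kinematic anti-dynamo threshold in Hubble flow** `C_kin(ν, a) ∈ [0, ∞]`: the supremum of
the levels `C ≥ 0` at which no admissible advecting field `U` (Type-I profile bounds at level `C`)
maintains a finite-energy field under `∂ₛB = νΔB + curl((U + a·y) × B)`, `div B = 0`:
`C_kin(ν, a) = sup {C ≥ 0 : KinematicHubbleAntiDynamo ν a C}` (`kinematicHubbleThreshold_eq_sSup`).
Always meaningful: `0` if even level `0` fails, `∞` if every level has the property
(`kinematicHubbleThreshold_eq_top_iff`); every level strictly below it has the property
(`kinematicHubbleAntiDynamo_of_ofReal_lt`). In Navier–Stokes units a level `C` corresponds to the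
magnetic Reynolds number `R_m = C² / (a ν)`. (Object posited by the Hubble-dynamo reading of Type-I
blow-up; no published source.) [folklore] -/
def kinematicHubbleThreshold (ν a : ℝ) : ℝ≥0∞ :=
  ⨆ (C : ℝ≥0) (_ : KinematicHubbleAntiDynamo ν a C), (C : ℝ≥0∞)

section Threshold

variable {ν a : ℝ}

/-- The threshold as the supremum of a set of levels, `sup {C ≥ 0 : KinematicHubbleAntiDynamo ν a C}`
read in `[0, ∞]`. [folklore] -/
theorem kinematicHubbleThreshold_eq_sSup (ν a : ℝ) :
    kinematicHubbleThreshold ν a =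
      sSup ((fun C : ℝ≥0 => (C : ℝ≥0∞)) '' {C : ℝ≥0 | KinematicHubbleAntiDynamo ν a C}) := by
  simp only [kinematicHubbleThreshold, sSup_image, mem_setOf_eq]

/-- A level with the anti-dynamo property is a lower bound for the threshold (`ℝ≥0` form). [folklore] -/
theorem coe_le_kinematicHubbleThreshold {C : ℝ≥0} (h : KinematicHubbleAntiDynamo ν a C) :
    (C : ℝ≥0∞) ≤ kinematicHubbleThreshold ν a :=
  le_iSup₂ (f := fun (C : ℝ≥0) (_ : KinematicHubbleAntiDynamo ν a C) => (C : ℝ≥0∞)) C h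

/-- A level with the anti-dynamo property is a lower bound for the threshold. [folklore] -/
theorem ofReal_le_kinematicHubbleThreshold {C : ℝ} (hC : 0 ≤ C)
    (h : KinematicHubbleAntiDynamo ν a C) : ENNReal.ofReal C ≤ kinematicHubbleThreshold ν a := by
  have h' : KinematicHubbleAntiDynamo ν a (C.toNNReal : ℝ) := by rwa [Real.coe_toNNReal C hC]
  exact coe_le_kinematicHubbleThreshold h'

/-- A level WITHOUT the anti-dynamo property bounds the threshold from above (`ℝ≥0` form;
by antitonicity no larger level has the property either). [folklore] -/
theorem kinematicHubbleThreshold_le_coe {C : ℝ≥0} (h : ¬ KinematicHubbleAntiDynamo ν a C) :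
    kinematicHubbleThreshold ν a ≤ C :=
  iSup₂_le fun _ h' => ENNReal.coe_le_coe.2
    (le_of_not_gt fun hlt => h (h'.anti (NNReal.coe_le_coe.2 hlt.le)))

/-- A level WITHOUT the anti-dynamo property is an upper bound for the threshold. [folklore] -/
theorem kinematicHubbleThreshold_le_ofReal {C : ℝ} (hC : 0 ≤ C)
    (h : ¬ KinematicHubbleAntiDynamo ν a C) : kinematicHubbleThreshold ν a ≤ ENNReal.ofReal C := by
  have h' : ¬ KinematicHubbleAntiDynamo ν a (C.toNNReal : ℝ) := by rwa [Real.coe_toNNReal C hC]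
  exact kinematicHubbleThreshold_le_coe h'

/-- Every level strictly below the threshold has the anti-dynamo property (`ℝ≥0` form). [folklore] -/
theorem kinematicHubbleAntiDynamo_of_coe_lt {C : ℝ≥0}
    (h : (C : ℝ≥0∞) < kinematicHubbleThreshold ν a) : KinematicHubbleAntiDynamo ν a C :=
  of_not_not fun hC => (kinematicHubbleThreshold_le_coe hC).not_gt h

/-- Every level strictly below the threshold has the anti-dynamo property: every admissible `U`
at such a level `C` maintains no field (for `C < 0` vacuously, by `of_neg`). [folklore] -/
theorem kinematicHubbleAntiDynamo_of_ofReal_lt {C : ℝ}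
    (h : ENNReal.ofReal C < kinematicHubbleThreshold ν a) : KinematicHubbleAntiDynamo ν a C := by
  rcases lt_or_ge C 0 with hC | hC
  · exact KinematicHubbleAntiDynamo.of_neg hC
  · exact of_not_not fun h' => (kinematicHubbleThreshold_le_ofReal hC h').not_gt h

/-- The threshold is infinite iff every level has the anti-dynamo property. [folklore] -/
theorem kinematicHubbleThreshold_eq_top_iff :
    kinematicHubbleThreshold ν a = ⊤ ↔ ∀ C : ℝ, KinematicHubbleAntiDynamo ν a C := by
  constructor
  · intro h C
    exact kinematicHubbleAntiDynamo_of_ofReal_lt (h ▸ ENNReal.ofReal_lt_top)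
  · intro h
    exact ENNReal.eq_top_of_forall_nnreal_le fun r => coe_le_kinematicHubbleThreshold (h r)

/-- The threshold vanishes iff no positive level has the anti-dynamo property. [folklore] -/
theorem kinematicHubbleThreshold_eq_zero_iff :
    kinematicHubbleThreshold ν a = 0 ↔ ∀ C : ℝ, 0 < C → ¬ KinematicHubbleAntiDynamo ν a C := by
  constructor
  · intro h C hC hK
    have := ofReal_le_kinematicHubbleThreshold hC.le hK
    rw [h, nonpos_iff_eq_zero, ENNReal.ofReal_eq_zero] at this
    exact this.not_gt hC
  · intro h
    refine le_antisymm (iSup₂_le fun C hK => ?_) bot_le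
    rcases eq_or_lt_of_le C.2 with hC | hC
    · have hC0 : C = 0 := NNReal.coe_eq_zero.1 hC.symm
      simp [hC0]
    · exact absurd hK (h C hC)

end Threshold

end Induction

end Literature.Analysis.FluidPDE
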